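import Summits.AnomalousDissipation.AnomalousDissipation.Theses.TwoAndHalfD
import Summits.AnomalousDissipation.AnomalousDissipation.Theorems.TwohalfdNeg.Negative.LoadBearing
import Literature.Analysis.FluidPDE.TwoHalfNavierStokes
import Literature.Analysis.FluidPDE.LongTimeAverageNonneg
import Literature.Analysis.FunctionSpaces.TorusAxisAverageCalculus
import Literature.Analysis.FunctionSpaces.TorusMaximalLipschitz
import HarnessLib.Audit

/-!
# Line `replica-log-cost-enstrophy-threshold` — skeleton for the crux `TwoAndHalfD.TwohalfdNeg`
(item stmt-AnomalousDissipation-0211; routes TwoAndHalfD #5 = Neg #3; crux-plan, round 1)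

Crux (FIXED, concluded BY NAME in `TwohalfdNeg_of`): for every steady smooth divergence-free mean-zero
`x₃`-invariant force `f` on `T³`, every `ν_j → 0` and every family of `x₃`-invariant global Leray–Hopf
solutions `u_j` of NS_{ν_j} forced by `f` with `sup_j ⟨‖u_j‖²⟩ < ∞`: `⟨ν_j‖∇u_j‖²⟩ → 0`.

Idea (card `Cruxes/TwohalfdNeg/Ideas/replica-log-cost-enstrophy-threshold.md`, ideator 1; triage r1-1/2/3:
pass ×3, trunk of the merge class {replica-log-cost ≈ log-kantorovich-enstrophy-transfer ≈ lusin-lipschitz-log-count},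
with `age-decoupling-finite-window` as the sourced→release adapter).  LEVER (`stub_logSplittingCost`): the
Crippa–De Lellis log functional `½log(1+|X¹-X²|²/κ)` on TWO NOISY REPLICAS of one backward Lagrangian particle of
the planar flow, plugged into the Drivas–Eyink two-replica identity `κ∫‖∇θ‖² = ¼∫E|A¹-A²|²` for the steadily
SOURCED third component: a finite-window, finite-`ν`, compactness-free bound
`κ∫_{t₀}^{t₀+T}‖∇θ‖² ≤ C(h)·(‖θ(t₀)‖² + ℓ²T² + T²(∫‖∇u‖₂ + T + 1)/log(1+ℓ²/κ))`
— old field paid by the ENERGY CEILING, source history paid by `∇h` of the ONE FIXED source, replica splitting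
paid LINEARLY by the time-integrated planar strain through the maximal function (tree:
`Torus.exists_maximal_majorant`).  Long-time averaging (`stub_subLogSqNoAnomaly`) proves the scalar half of the
crux on every family whose limsup-mean planar enstrophy is `o(log²(1/ν_j))` ⊋ {first-shell, single-shell,
purely-vertical-force sub-cases}; the planar velocity half is Alexakis–Doering (`stub_planarEnergyDissipationVanishes`);
the 2½-D bookkeeping is `stub_twoHalfSplit`.  The RESIDUAL (high-enstrophy branch `Z_j ≥ c·log²(1/ν_j)`) is stated,
as the triage panel asked (r1-1 "state the residual in its honest Lagrangian form", r1-2 "FiniteWindowQuiet, not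
SubLogVorticity", r1-3 "K1 is the open residual, not a stub"), in the velocity-only FINITE-WINDOW RELEASE form
`stub_highEnstrophyQuiet` (free releases of the fixed smooth datum `h` lose `o(1)` variance within every fixed age,
in long-time mean over release times) and converted to the scalar half by the age-decoupling inequality
`χ ≤ R/(2S) + √(2R·D̄(S))` of card `age-decoupling-finite-window` (`stub_ageDecoupling`, its `h`-threaded K2).

## Architecture (6 registered stubs + kernel-checked composition)

* S1 `stub_logSplittingCost : LogSplittingCost` — THE ENGINE (size L).  Uses the energy ceiling at the old-field
  term (Disproof `twohalfdNeg_false_without_energyBound`) and the fixed `W^{1,∞}` source through `C = C(‖h‖_∞,‖∇h‖_∞)`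
  (Disproof `twohalfdNeg_false_without_fixedForce`: for `f_j = 4π²cos(2π(j+1)x₀)e₃` the constant blows up like
  `(j+1)²`, as it must).
* S2 `stub_subLogSqNoAnomaly : LogSplittingCost → SubLogSqNoAnomaly` — offset-averaged long-time corollary (size M):
  scalar half of the crux on `{Z_j = o(log²(1/ν_j))}`.
* S3 `stub_planarEnergyDissipationVanishes` — Alexakis–Doering 2006 §2 at `L²` data and general smooth `g` (size M).
* S4 `stub_twoHalfSplit` — `u_j = twoHalf v_j θ_j`: `v_j` is 2-D Leray–Hopf under `g`, `θ_j` a weak sourced scalar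
  under `h`, means bounded by `E`, `meanDissipation u_j ≤ meanDissipation v_j + ⟨ν_j‖∇θ_j‖²⟩` (size M/L).
* S5 `stub_ageDecoupling : AgeDecoupling` — quiet releases of `h` ⇒ no scalar anomaly (size M; card
  age-decoupling-finite-window (★★), verified line by line by all three triagers).
* S6 `stub_highEnstrophyQuiet : HighEnstrophyQuiet` — THE RESIDUAL BET (size XL, open): bounded-energy planar
  Leray–Hopf families under a steady smooth `g` with `Z_j ≥ c·log²(1/ν_j)` release the smooth datum `h` quietly.
* `twohalfdNeg_glue` (parametric, crux body unfolded) and `TwohalfdNeg_of : TwohalfdNeg` (by name): subsequence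
  dichotomy on `Z_j / log²(1/ν_j)` (`Filter.tendsto_of_subseq_tendsto`, `Filter.extraction_forall_of_frequently`),
  then `squeeze_zero` with `meanDissipation_nonneg`.  Real proof, no `sorry` outside the six stubs.

Disproof.lean (tree `Cruxes/TwohalfdNeg/Disproof.lean`, cdisprove cycle 1; certified copies under
`Theorems/TwohalfdNeg/Negative/`: `LoadBearing` (+ `LaminarShear`) IMPORTED below and restated in §0; `ZeroMeanAndKillShape`
cited only — the farm had not built that module at publication, re-add its import when it has) honoured: `_false_without_energyBound` — the energy ceiling is consumed by S2/S5
(old-field / variance term `R ≤ E`) and S3 (`U` bounded); `_false_without_fixedForce` — S1's constant depends on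
`‖h‖_{C¹}` of ONE fixed `h`, S6 releases ONE fixed smooth datum; `_false_without_vanishingViscosity` — `ν_j → 0`
is used in S2 (`log(1/ν_j) → ∞`), S3, S6; `_false_without_zeroMeanForce` — `HasZeroMean h` is carried by every
scalar-side stub (conserved scalar mean ⇒ honest variance limsups); `twohalfdNeg_iff_not_twohalfdThesis` — S6 false
⇔ (morally) an `X`-witness: its why-might-fail is exactly route TwoAndHalfD's #2/#3.  No stub is an instance of a
landed Negative lemma (those refute hypothesis-DELETED versions of the crux; every stub keeps all hypotheses it uses).
-/

set_option linter.dupNamespace false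

noncomputable section

open MeasureTheory Set Filter Topology
open scoped ENNReal NNReal

namespace Summit.AnomalousDissipation.AnomalousDissipation.Cruxes.TwohalfdNeg.ReplicaLogCostEnstrophyThreshold

open Literature.Analysis.FunctionSpaces Literature.Analysis.FluidPDE
open Summit.AnomalousDissipation.AnomalousDissipation.Theses.TwoAndHalfD

/-- The flat two-torus (local notation). -/
local notation "𝕋²" => UnitAddTorus (Fin 2)
/-- The flat three-torus (local notation). -/
local notation "𝕋³" => UnitAddTorus (Fin 3)
/-- Planar vectors (local notation). -/
local notation "E²" => EuclideanSpace ℝ (Fin 2)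
/-- Spatial vectors (local notation). -/
local notation "E³" => EuclideanSpace ℝ (Fin 3)

/-! ## §0 Sanity: the landed Negative lemmas are in scope (kill shape `twohalfdNeg_iff_not_twohalfdThesis` lives in
`Negative/ZeroMeanAndKillShape.lean`, not imported here only because the farm had not built it at publication) -/

/-- The fixed-force hypothesis is load-bearing (landed, `Negative/LoadBearing.lean`): S1's constant `C(h)` and S6's
single datum `h` are where this line uses it. [folklore] -/
example : ¬ Summit.AnomalousDissipation.AnomalousDissipation.Theorems.TwohalfdNeg.Negative.TwohalfdNegWithoutFixedForce :=
  Summit.AnomalousDissipation.AnomalousDissipation.Theorems.TwohalfdNeg.Negative.twohalfdNeg_false_without_fixedForce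

/-- The energy ceiling is load-bearing (landed): consumed at the old-field term of S1/S2, at `R ≤ E` in S5 and at
`U ≤ √E` in S3. [folklore] -/
example : ¬ Summit.AnomalousDissipation.AnomalousDissipation.Theorems.TwohalfdNeg.Negative.TwohalfdNegWithoutEnergyBound :=
  Summit.AnomalousDissipation.AnomalousDissipation.Theorems.TwohalfdNeg.Negative.twohalfdNeg_false_without_energyBound

/-! ## §1 Vocabulary of the line (2-D language of route TwoAndHalfD; all over existing declarations) -/

/-- **The engine's statement (first lemma of the idea card, verbatim).**  For a smooth steady source `h` on `T²`
there is `C = C(‖h‖_∞, ‖∇h‖_∞)` such that for every diffusivity `0 < κ ≤ 1/2`, every smooth divergence-free drift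
`u` and classical solution `θ` of `∂ₜθ + u·∇θ = κΔθ + h` on `(0,∞) × T²`, every window `[t₀, t₀+T] ⊂ (0,∞)` and
every separation scale `ℓ > 0`:
`κ∫_{t₀}^{t₀+T}‖∇θ‖² ≤ C·(‖θ(t₀)‖² + ℓ²T² + T²·(∫_{t₀}^{t₀+T}‖∇u(s)‖_{L²}ds + T + 1)/log(1+ℓ²/κ))`.
Paper proof (triage r1-1 §pass, r1-3 App. A1): Drivas–Eyink two-replica FDR `κ∫‖∇θ‖² = ¼∫E|A¹-A²|²`,
`Aⁱ = θ(Xⁱ_{t₀},t₀) + ∫h(Xⁱ_s)ds` (backward replicas, same `u`, independent `√(2κ)` noises, common endpoint);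
old field `≤ 2‖θ(t₀)‖²` (each replica Lebesgue-distributed); unsplit pairs `≤ ½‖∇h‖²_∞ℓ²T²`; split pairs
`≤ 4‖h‖²_∞T²·m`, and the split fraction `m ≤ (C'∫‖∇u‖₂ + 4T + C''√T)/(½log(1+ℓ²/κ))` from
`Φ = ½log(1+|X¹-X²|²/κ)`: Itô drift `≤ 4`, `⟨Mart⟩' ≤ 1`, transport term `≤ C(M∇u(X¹)+M∇u(X²))`
(`Torus.exists_maximal_majorant`), measure preservation, Markov + Doob.  SDE-free Eulerian twin (r1-3 App. A2):
two-point density of the doubled equation on `T² × T²`, Duhamel in the starting time, same constants. -/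
def LogSplittingCost : Prop :=
  ∀ h : 𝕋² → ℝ, Torus.IsSmooth h →
    ∃ C : ℝ, 0 ≤ C ∧
      ∀ (κ : ℝ) (u : ℝ → 𝕋² → E²) (θ : ℝ → 𝕋² → ℝ),
        0 < κ → κ ≤ 1 / 2 →
        Torus.IsClassicalScalarTransportForcedOn (Set.Ioi 0) κ u (fun _ => h) θ →
        ∀ (t₀ T ℓ : ℝ), 0 < t₀ → 0 < T → 0 < ℓ →
          Torus.scalarDissipation κ θ t₀ (t₀ + T) ≤
            C * (Torus.scalarL2Sq (θ t₀) + ℓ ^ 2 * T ^ 2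
              + T ^ 2 * ((∫ s in t₀..(t₀ + T), Real.sqrt (Torus.gradNormSq (u s))) + T + 1)
                / Real.log (1 + ℓ ^ 2 / κ))

/-- **The scalar half of the crux in 2-D language, under an extra hypothesis `Hyp h ν v` on the source/planar
flows** (shape shared with `SketchIdeator3.ScalarHalfUnder`, with the source `h` threaded through `Hyp` as triage
r1-1 asked): steady smooth divergence-free mean-zero planar force `g`, steady smooth mean-zero source `h`,
`ν_j → 0`, planar global Leray–Hopf flows `v_j` (force `g`, `L²` data), weak sourced scalars `θ_j`
(`∂ₜθ + v_j·∇θ = ν_jΔθ + h`, Prandtl number one, `L²` data) with limsup-mean planar energy and scalar `L²` mass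
bounded uniformly in `j`; conclusion: the limsup-mean scalar dissipation `⟨ν_j‖∇θ_j‖²⟩ → 0`
(spectral `eScalarGradNormSq`, `toReal`, `longTimeAvgSup` — the conventions of `meanDissipation`). -/
def ScalarHalfUnder (Hyp : (𝕋² → ℝ) → (ℕ → ℝ) → (ℕ → ℝ → 𝕋² → E²) → Prop) : Prop :=
  ∀ (g : 𝕋² → E²) (h : 𝕋² → ℝ), Torus.IsSmooth g → Torus.IsDivFree g → Torus.HasZeroMean g →
    Torus.IsSmooth h → Torus.HasZeroMean h →
    ∀ (ν : ℕ → ℝ) (v₀ : ℕ → 𝕋² → E²) (v : ℕ → ℝ → 𝕋² → E²) (θ₀ : ℕ → 𝕋² → ℝ) (θ : ℕ → ℝ → 𝕋² → ℝ),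
      (∀ j, 0 < ν j) → Tendsto ν atTop (𝓝 0) →
      (∀ j, Torus.IsGlobalLerayHopf (ν j) (fun _ => g) (v₀ j) (v j)) →
      (∀ j, MemLp (θ₀ j) 2 volume) →
      (∀ j, Torus.IsWeakScalarTransportForced (ν j) (v j) (fun _ => h) (θ₀ j) (θ j)) →
      (∃ E : ℝ, ∀ j, meanEnergy (v j) ≤ E) →
      (∃ E : ℝ, ∀ j, longTimeAvgSup (fun t => Torus.scalarL2Sq (θ j t)) ≤ E) →
      Hyp h ν v →
      Tendsto (fun j => longTimeAvgSup (fun t => ν j * (Torus.eScalarGradNormSq (θ j t)).toReal)) atTop (𝓝 0)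

/-- The limsup long-time mean planar enstrophy `Z_j = ⟨‖∇v_j‖²⟩` (spectral, `toReal`; the dichotomy variable). -/
def meanEnstrophy (v : ℝ → 𝕋² → E²) : ℝ :=
  longTimeAvgSup (fun t => (Torus.eGradNormSq (v t)).toReal)

/-- **Sub-log² branch hypothesis**: `Z_j / log²(1/ν_j) → 0` (the source `h` is not used). Contains every settled
sub-case (first shell, single shell, purely vertical force: `Z_j = O(1)`) and Kraichnan's log-corrected enstrophy
cascade (`Z_j ~ log^{2/3}`). -/
def SubLogSqEnstrophy (_h : 𝕋² → ℝ) (ν : ℕ → ℝ) (v : ℕ → ℝ → 𝕋² → E²) : Prop :=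
  Tendsto (fun j => meanEnstrophy (v j) / Real.log (1 / ν j) ^ 2) atTop (𝓝 0)

/-- **Quiet releases of the datum `h`** (card `age-decoupling-finite-window`'s `FiniteWindowQuiet`, with the datum
fixed to the source `h` — triage r1-1 — and the releases started at times `s + 1 ≥ 1`, where a 2-D Leray–Hopf
drift under a smooth force is smooth and bounded, so that every member of every admissible family IS a release —
it exists and is the unique energy solution by the tree's `exists_isWeakScalarTransportOn_holds` /
`unique_of_lipschitz_holds` / `energy_ineq_holds` — and no unconstrained junk enters the Cesàro means, which are
shift-invariant anyway): for every age `S > 0` and every family `ϑ j s` of weak solutions of the UNFORCED equation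
`∂_τϑ + v_j(s+1+τ)·∇ϑ = ν_jΔϑ`, `ϑ(0) = h` on `[0, S+1)` (one per level `j` and index `s ≥ 0`), the variance
`ν_j∫₀^S‖∇ϑ‖²` lost within age `S` tends to `0` in limsup long-time mean over `s`, as `j → ∞`.  (Lagrangian
reading: backward two-replica pairs of the planar flow do not separate to scale `O(1)` within time `S`, on
average over the release time.) -/
def QuietReleases (h : 𝕋² → ℝ) (ν : ℕ → ℝ) (v : ℕ → ℝ → 𝕋² → E²) : Prop :=
  ∀ S : ℝ, 0 < S → ∀ ϑ : ℕ → ℝ → ℝ → 𝕋² → ℝ,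
    (∀ j (s : ℝ), 0 ≤ s → Torus.IsWeakScalarTransportOn (S + 1) (ν j) (fun τ => v j (s + 1 + τ)) h (ϑ j s)) →
    Tendsto (fun j => longTimeAvgSup (fun s => (Torus.eScalarDissipation (ν j) (ϑ j s) 0 S).toReal)) atTop (𝓝 0)

/-- **S2's conclusion**: no scalar anomaly on the sub-log² class. -/
def SubLogSqNoAnomaly : Prop := ScalarHalfUnder SubLogSqEnstrophy

/-- **S5's statement** (card age-decoupling-finite-window, K2, `h`-threaded): quiet releases of the source pattern ⇒
no anomaly of the sourced scalar, via `S·χ_j ≤ R_j/2 + S·√(2R_j·D̄_j(S))`. -/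
def AgeDecoupling : Prop := ScalarHalfUnder QuietReleases

/-- **S3's statement — the planar velocity half** (Alexakis–Doering 2006 §2 for a general fixed smooth force and
`L²` data): bounded limsup-mean energy forces `⟨ν_j‖∇v_j‖²⟩ → 0` for 2-D global Leray–Hopf families under a steady
smooth divergence-free mean-zero `g`.  In tree for forcing shapes and smooth data:
`Literature.Barriers.AnomalousDissipation.AlexakisDoering2006_energyDissipationBound(_holds)`,
`.no_twoDimensional_zerothLaw`; here: `g = ‖g‖₂·Φ` with `n = 1` (or `g = 0`: `ε_j ≤ ⟨(g,v_j)⟩ = 0` by the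
Doering–Foias power budget), `L²` data handled by restarting at `t = 1` (2-D Leray–Hopf flows are smooth for
`t > 0`; a finite head does not change limsup means of a locally integrable nonnegative integrand), `U_j = 0`
handled by `ε_j ≤ ‖g‖₂ U_j`. -/
def PlanarEnergyDissipationVanishes : Prop :=
  ∀ g : 𝕋² → E², Torus.IsSmooth g → Torus.IsDivFree g → Torus.HasZeroMean g →
    ∀ (ν : ℕ → ℝ) (v₀ : ℕ → 𝕋² → E²) (v : ℕ → ℝ → 𝕋² → E²),
      (∀ j, 0 < ν j) → Tendsto ν atTop (𝓝 0) →
      (∀ j, Torus.IsGlobalLerayHopf (ν j) (fun _ => g) (v₀ j) (v j)) →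
      (∃ E : ℝ, ∀ j, meanEnergy (v j) ≤ E) →
      Tendsto (fun j => meanDissipation (ν j) (v j)) atTop (𝓝 0)

/-- **S4's statement — the `2½`-dimensional split** (route TwoAndHalfD's foreseen glue `ScalarLift2halfD`, read in
the easy direction; Majda–Bertozzi Prop. 2.7).  An `x₃`-invariant global Leray–Hopf family under an `x₃`-invariant
steady smooth force splits as `f = twoHalf g h`, `u_j(t) = twoHalf (v_j t) (θ_j t)`
(`Torus.eq_twoHalf_of_forall_add_single`) with: `g` smooth divergence-free mean-zero, `h` smooth mean-zero (Fubini);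
`v_j` a 2-D GLOBAL LERAY–HOPF solution under `g` (weak identity tested with `x₃`-independent planar fields;
`L^∞L² ∩ L²H¹` from `u_j`; the planar energy inequality from the 2-D energy EQUALITY of Leray-class weak solutions,
Lions–Prodi / Ladyzhenskaya; weak continuity and strong initial trace inherited); `θ_j` a weak SOURCED scalar over
`v_j` with source `h` and `L²` datum (weak NS identity tested with vertical fields `ψ(t,x₁,x₂)e₃`); the mean bounds
from `∫‖u‖² = ∫‖v‖² + ∫θ²` (`Torus.integral_norm_sq_twoHalf`, measure-preserving `planarProj`); and the dissipation
split from `eGradNormSq (twoHalf V R) = eGradNormSq V + eScalarGradNormSq R` (Fourier support on `k₃ = 0`;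
smooth case `Torus.toReal_eGradNormSq_twoHalf`) plus subadditivity of `limsup` Cesàro means of two nonnegative
locally integrable functions (finite at fixed `j` by the energy inequality). -/
def TwoHalfSplit : Prop :=
  ∀ f : 𝕋³ → E³, (∀ (s : UnitAddCircle) (x : 𝕋³), f (x + Pi.single (2 : Fin 3) s) = f x) →
    Torus.IsSmooth f → Torus.IsDivFree f → Torus.HasZeroMean f →
    ∀ (ν : ℕ → ℝ) (u₀ : ℕ → 𝕋³ → E³) (u : ℕ → ℝ → 𝕋³ → E³),
      (∀ j, 0 < ν j) →
      (∀ j, Torus.IsGlobalLerayHopf (ν j) (fun _ => f) (u₀ j) (u j)) →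
      (∀ j (t : ℝ) (s : UnitAddCircle) (x : 𝕋³), u j t (x + Pi.single (2 : Fin 3) s) = u j t x) →
      (∃ E : ℝ, ∀ j, meanEnergy (u j) ≤ E) →
      ∃ (g : 𝕋² → E²) (h : 𝕋² → ℝ) (v₀ : ℕ → 𝕋² → E²) (v : ℕ → ℝ → 𝕋² → E²)
        (θ₀ : ℕ → 𝕋² → ℝ) (θ : ℕ → ℝ → 𝕋² → ℝ),
        f = Torus.twoHalf g h ∧ (∀ j (t : ℝ), u j t = Torus.twoHalf (v j t) (θ j t)) ∧
        Torus.IsSmooth g ∧ Torus.IsDivFree g ∧ Torus.HasZeroMean g ∧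
        Torus.IsSmooth h ∧ Torus.HasZeroMean h ∧
        (∀ j, Torus.IsGlobalLerayHopf (ν j) (fun _ => g) (v₀ j) (v j)) ∧
        (∀ j, MemLp (θ₀ j) 2 volume) ∧
        (∀ j, Torus.IsWeakScalarTransportForced (ν j) (v j) (fun _ => h) (θ₀ j) (θ j)) ∧
        (∃ E : ℝ, ∀ j, meanEnergy (v j) ≤ E) ∧
        (∃ E : ℝ, ∀ j, longTimeAvgSup (fun t => Torus.scalarL2Sq (θ j t)) ≤ E) ∧
        (∀ j, meanDissipation (ν j) (u j) ≤
          meanDissipation (ν j) (v j) + longTimeAvgSup (fun t => ν j * (Torus.eScalarGradNormSq (θ j t)).toReal))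

/-- **S6's statement — THE RESIDUAL (high-enstrophy branch, velocity-only, finite-window form).**  For a steady
smooth divergence-free mean-zero `g`, a smooth mean-zero datum `h`, `ν_j → 0` and 2-D global Leray–Hopf flows `v_j`
under `g` with bounded limsup-mean energy whose limsup-mean enstrophy is LARGE, `Z_j ≥ c·log²(1/ν_j)` (`c > 0`):
free releases of `h` into `v_j` are quiet in every fixed age window (`QuietReleases`).  This is where the crux is
open: its failure is (morally, via `stub_ageDecoupling` read backwards: `χ ≥ ε, R ≤ E ⇒ D̄(E/ε) ≥ ε²/(8E)`) an
`X`-witness of route TwoAndHalfD — a bounded-energy steadily forced planar flow splitting noisy replica pairs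
through `½log₂(1/ν)` octaves in `O(1)` time at bounded enstrophy throughput `χ_j ≤ ‖Δg‖₂√E`
(super-Kraichnan small-scale strain).  A priori only `Z_j ≲ ν_j^{-1/2}` (Alexakis–Doering) is known; tools for it:
frozen-enstrophy near-invariance (card K1b / `SketchIdeator1.SourcedScalarNearInvariance`), autonomous weak-Sard
rigidity (arXiv:2603.11466 Thm 1.2) for steady-attracted states, the band pincer
`Literature.Barriers.AnomalousDissipation.GravestModeLaminarAttractorBandPincer` (negative low-shell work
`≳ ν log²` is necessary for `Z ≳ log²` under band-limited `g`). -/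
def HighEnstrophyQuiet : Prop :=
  ∀ (g : 𝕋² → E²) (h : 𝕋² → ℝ), Torus.IsSmooth g → Torus.IsDivFree g → Torus.HasZeroMean g →
    Torus.IsSmooth h → Torus.HasZeroMean h →
    ∀ (ν : ℕ → ℝ) (v₀ : ℕ → 𝕋² → E²) (v : ℕ → ℝ → 𝕋² → E²) (c : ℝ),
      (∀ j, 0 < ν j) → Tendsto ν atTop (𝓝 0) → 0 < c →
      (∀ j, Torus.IsGlobalLerayHopf (ν j) (fun _ => g) (v₀ j) (v j)) →
      (∃ E : ℝ, ∀ j, meanEnergy (v j) ≤ E) →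
      (∀ j, c * Real.log (1 / ν j) ^ 2 ≤ meanEnstrophy (v j)) →
      QuietReleases h ν v

/-! ## §2 Registered stubs -/

/-- **stub_logSplittingCost** (S1, size L; THE LEVER).  The sourced two-replica / Crippa–De Lellis log-cost
inequality `LogSplittingCost`.  Why plausibly true: re-derived by hand by triagers r1-1, r1-2, r1-3 (constants
`4`, `1`, `C·(M∇u(X¹)+M∇u(X²))` of the Itô computation; degenerate checks `u = 0`, laminar family of Disproof §1–§3);
toy job j009746 (split fraction in random-phase sine shears) pre-registered by r1-1.  Leans on:
`Torus.IsClassicalScalarTransportForcedOn`, `Torus.scalarDissipation`, `Torus.scalarL2Sq`, `Torus.gradNormSq`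
(tree); `Torus.exists_maximal_majorant` (tree, proved: the CDL maximal-function Lipschitz estimate on `T^d`);
Eulerian proof route: classical well-posedness/maximum principle for advection–diffusion on `T² × T²`
(`PassiveScalarWellPosedness`, `ScalarFourierPicard`, `PassiveScalarClassicalEnergy`), Markov; Lagrangian route
needs stochastic flows (not in Mathlib).  Sources: DrivasEyink2017 (arXiv:1606.00729) §2 (FDR), §4;
CrippaDeLellis2008 (J. reine angew. Math. 616) log functional; Seis 2013/2022 (arXiv:2003.08794, Lemma 3). -/
theorem stub_logSplittingCost : LogSplittingCost := by
  sorry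

/-- **stub_subLogSqNoAnomaly** (S2, size M; the offset-averaged long-time corollary, triage r1-2 "add it as the
SECOND stub, since the lattice-sample → Cesàro step is where limsup junk can bite").  From `LogSplittingCost`:
for `j` large (`ν_j ≤ 1/2`), `θ_j` is a.e. the classical solution on `(0,∞)` (2-D Leray–Hopf drift is smooth for
`t > 0`; DiPerna–Lions uniqueness in `L^∞L²` with `∇v ∈ L¹L²`), apply S1 on `[t₀, t₀+T]` and AVERAGE OVER THE
OFFSET `t₀ ∈ [1, τ]`: `T·⟨ν_j‖∇θ_j‖²⟩ ≤ C(⟨‖θ_j‖²⟩ + ℓ²T² + T²(T⟨‖∇v_j‖₂⟩ + T + 1)/log(1+ℓ²/ν_j))` with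
`⟨‖∇v_j‖₂⟩ ≤ √Z_j` (Jensen on Cesàro means, then limsup); choose `ℓ² = √ν_j` (`log(1+ℓ²/ν_j) ≥ ½log(1/ν_j)`):
`limsup_j ⟨ν_j‖∇θ_j‖²⟩ ≤ C·E/T` for every `T` because `√Z_j = o(log(1/ν_j))`; let `T → ∞`.
Leans on: S1; `longTimeAvgSup`/`timeMean` API (`TurbWave0`, `LongTimeAverageNonneg`, `ZerothLawProofs`),
`Torus.IsWeakScalarTransportForced`, 2-D regularity (`NSStrongSolutions2D`, `lions_prodi_uniqueness_torus2`),
`PassiveScalarWellPosedness` / `PassiveScalar.unique_of_lipschitz`. -/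
theorem stub_subLogSqNoAnomaly : LogSplittingCost → SubLogSqNoAnomaly := by
  sorry

/-- **stub_planarEnergyDissipationVanishes** (S3, size M; Alexakis–Doering at `L²` data).  See
`PlanarEnergyDissipationVanishes`.  Leans on: `AlexakisDoering2006_energyDissipationBound_holds`,
`AlexakisDoering2006_dissipation_sq_le_holds`, `alexakis_doering_enstrophy_bound_holds` (tree, proved, forcing-shape
form), `DoeringFoias2002_dissipation_le_power_holds` (`ε ≤ ‖f‖₂√E`), Leray–Hopf restart
(`LerayHopfRestart`, `LerayHopfRegularRestart`), 2-D smoothing (`NSStrongSolutions2D`), shift-invariance of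
`longTimeAvgSup` for locally integrable nonnegative integrands.  Source: AlexakisDoering2006PLA §2
(`ε² ≤ νU²χ`, `χ ≤ ‖Δg‖₂U`). -/
theorem stub_planarEnergyDissipationVanishes : PlanarEnergyDissipationVanishes := by
  sorry

/-- **stub_twoHalfSplit** (S4, size M/L; the `2½`-D bookkeeping).  See `TwoHalfSplit`.  Leans on:
`Torus.eq_twoHalf_of_forall_add_single`, `Torus.twoHalf` API (`TorusPlanarLift`, `TwoHalfNavierStokes`:
`integral_norm_sq_twoHalf`, `toReal_eGradNormSq_twoHalf`, `memLp_twoHalf`, `hasZeroMean_twoHalf`,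
`IsDivFree.twoHalf`), the weak-form splitting machinery of `TwoHalfWeakEuler` (`weakIdentity_twoHalf`,
`isWeaklyDivFree_twoHalf`, axis averages `TorusAxisAverageCalculus`) extended by the viscous term, the 2-D energy
equality (`NSLionsEnergyEquality`, `NSUniqueness2DLadyzhenskaya`), `LerayHopfSpectralMeasurability`,
`longTimeAvgSup` subadditivity.  Why it might fail: only bookkeeping (measurability of slices, `toReal` of a sum of
a.e.-finite quantities, Cesàro subadditivity needs the per-`j` boundedness supplied by the energy inequality). -/
theorem stub_twoHalfSplit : TwoHalfSplit := by
  sorry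

/-- **stub_ageDecoupling** (S5, size M; card `age-decoupling-finite-window` K2 with `h` threaded — shared stub,
whichever line lands it first).  `AgeDecoupling = ScalarHalfUnder QuietReleases`: with `a(σ) = P_{t-σ,t}h`,
`b = P_{t-σ,t}θ(t-σ)`, `d/ds(a,b) = -2ν(∇a,∇b)` (div-free drift), `|(h,θ(t-σ)) - (a_σ,b(t))| ≤ √(2D_h(t;σ))‖θ(t-σ)‖`,
Duhamel `b(t) = θ(t) - Y_σ`, `∫₀^S(a_σ, θ(t))dσ = (Y_S,θ(t))`, `∫₀^S(a_σ,Y_σ)dσ = ½‖Y_S‖²`, complete the square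
`(Y,θ) - ½‖Y‖² ≤ ½‖θ‖²`; limsup bookkeeping (shift-invariance, scalar energy equality at `ν_j > 0` turns `⟨(h,θ_j)⟩`
into `χ_j`, Cauchy–Schwarz in time, reverse Fatou): `Sχ_j ≤ R_j/2 + S√(2R_j·D̄_j(S))`, so `D̄_j(S) → 0 ∀S` and
`R_j ≤ E` give `limsup χ_j ≤ E/(2S) → 0`.  Verified line by line by triage r1-1/2/3 (incl. the `v = 0` tightness
check).  Leans on: `Torus.IsWeakScalarTransportOn/Forced`, `Torus.eScalarDissipation`, existence + uniqueness of
weak releases over a 2-D Leray–Hopf drift (`PassiveScalarExistenceProofs`, `PassiveScalarWellPosedness`,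
DiPerna–Lions), Mathlib inner-product Cauchy–Schwarz.  Source: card age-decoupling-finite-window (folder
derivation); ShawThiffeaultDoering2007 (arXiv:physics/0607270) p.5 for the transient/steady distinction. -/
theorem stub_ageDecoupling : AgeDecoupling := by
  sorry

/-- **stub_highEnstrophyQuiet** (S6, THE RESIDUAL BET; size XL, open; held by the lead).  See `HighEnstrophyQuiet`.
Why it might fail: an `X`-witness (route TwoAndHalfD #2 `ScalarAnomalySteadySourceFormal` ∧ #3
`TwodBoundedEnergyZeroMomentum`): a bounded-energy steadily forced planar Leray–Hopf family that dissipates a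
fixed fraction of a smooth blob's variance in fixed time — necessarily with `Z_j ≳ log²(1/ν_j)` (S1) yet
`Z_j ≲ ν_j^{-1/2}` and `χ_j ≤ ‖Δg‖₂√E` (Alexakis–Doering); nothing of the kind is in print for a FIXED force
(BrueDeLellis2023 Q2.1 open; arXiv:2409.03599, 2311.04182 use `ν`-dependent forces).  Sources:
AlexakisDoering2006PLA §2; arXiv:2603.11466 Thm 1.2; Literature.Barriers.AnomalousDissipation.GravestModeLaminarAttractorBandPincer;
ConstantinTarfuleaVicol2013 p.3; GalletYoung2013. -/
theorem stub_highEnstrophyQuiet : HighEnstrophyQuiet := by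
  sorry

/-! ## §3 Kernel-checked composition -/

/-- **The glue, parametric in the six statements** (crux body unfolded so that only `TwohalfdNeg_of` concludes the
crux by name).  Split (S4); planar half → 0 (S3); scalar half → 0 by the subsequence dichotomy on
`Z_j / log²(1/ν_j)`: a subsequence along which it tends to `0` is handled by S2 ∘ S1, a subsequence along which it
stays `≥ c > 0` by S5 ∘ S6; squeeze with `0 ≤ meanDissipation`. [folklore] -/
theorem twohalfdNeg_glue (h₁ : LogSplittingCost) (h₂ : LogSplittingCost → SubLogSqNoAnomaly)
    (h₃ : PlanarEnergyDissipationVanishes) (h₄ : TwoHalfSplit) (h₅ : AgeDecoupling) (h₆ : HighEnstrophyQuiet) :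
    ∀ f : 𝕋³ → E³, (∀ (s : UnitAddCircle) (x : 𝕋³), f (x + Pi.single (2 : Fin 3) s) = f x) →
      Torus.IsSmooth f → Torus.IsDivFree f → Torus.HasZeroMean f →
      ∀ (ν : ℕ → ℝ) (u₀ : ℕ → 𝕋³ → E³) (u : ℕ → ℝ → 𝕋³ → E³),
        (∀ j, 0 < ν j) → Tendsto ν atTop (𝓝 0) →
        (∀ j, Torus.IsGlobalLerayHopf (ν j) (fun _ => f) (u₀ j) (u j)) →
        (∀ j (t : ℝ) (s : UnitAddCircle) (x : 𝕋³), u j t (x + Pi.single (2 : Fin 3) s) = u j t x) →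
        (∃ E : ℝ, ∀ j, meanEnergy (u j) ≤ E) →
        Tendsto (fun j => meanDissipation (ν j) (u j)) atTop (𝓝 0) := by
  intro f hfi hfs hfd hfm ν u₀ u hν hν0 hLH hui hE
  obtain ⟨g, h, v₀, v, θ₀, θ, -, -, hgs, hgd, hgm, hhs, hhm, hvLH, hθ₀, hθ, hEv, hEθ, hsplit⟩ :=
    h₄ f hfi hfs hfd hfm ν u₀ u hν hLH hui hE
  have hSub : SubLogSqNoAnomaly := h₂ h₁
  -- the scalar dissipation and the dichotomy variable
  set D : ℕ → ℝ := fun j => longTimeAvgSup (fun t => ν j * (Torus.eScalarGradNormSq (θ j t)).toReal) with hD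
  set Z : ℕ → ℝ := fun j => meanEnstrophy (v j) with hZ
  have hZnn : ∀ j, 0 ≤ Z j := fun j => longTimeAvgSup_nonneg fun _ => ENNReal.toReal_nonneg
  -- scalar half: D → 0, by subsequences
  have hD0 : Tendsto D atTop (𝓝 0) := by
    refine tendsto_of_subseq_tendsto fun ns hns => ?_
    by_cases hB : ∃ c : ℝ, 0 < c ∧ ∀ᶠ k in atTop, c * Real.log (1 / ν (ns k)) ^ 2 ≤ Z (ns k)
    · -- HIGH-ENSTROPHY subsequence: S6 then S5
      obtain ⟨c, hc, hev⟩ := hB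
      obtain ⟨K, hK⟩ := eventually_atTop.1 hev
      have hms : Tendsto (fun n : ℕ => n + K) atTop atTop := tendsto_add_atTop_nat K
      have hns' : Tendsto (fun n : ℕ => ns (n + K)) atTop atTop := hns.comp hms
      refine ⟨fun n => n + K, ?_⟩
      have hq : QuietReleases h (fun n => ν (ns (n + K))) (fun n => v (ns (n + K))) :=
        h₆ g h hgs hgd hgm hhs hhm (fun n => ν (ns (n + K))) (fun n => v₀ (ns (n + K)))
          (fun n => v (ns (n + K))) c (fun n => hν _) (hν0.comp hns') hc (fun n => hvLH _)
          (by obtain ⟨E', hE'⟩ := hEv; exact ⟨E', fun n => hE' _⟩)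
          (fun n => hK (n + K) (Nat.le_add_left K n))
      exact h₅ g h hgs hgd hgm hhs hhm (fun n => ν (ns (n + K))) (fun n => v₀ (ns (n + K)))
        (fun n => v (ns (n + K))) (fun n => θ₀ (ns (n + K))) (fun n => θ (ns (n + K)))
        (fun n => hν _) (hν0.comp hns') (fun n => hvLH _) (fun n => hθ₀ _) (fun n => hθ _)
        (by obtain ⟨E', hE'⟩ := hEv; exact ⟨E', fun n => hE' _⟩)
        (by obtain ⟨E', hE'⟩ := hEθ; exact ⟨E', fun n => hE' _⟩) hq
    · -- SUB-LOG² subsequence: S2 ∘ S1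
      have hB' : ∀ n : ℕ, ∃ᶠ k in atTop,
          Z (ns k) < (1 / ((n : ℝ) + 1)) * Real.log (1 / ν (ns k)) ^ 2 := by
        intro n
        by_contra hcon
        apply hB
        refine ⟨1 / ((n : ℝ) + 1), by positivity, ?_⟩
        rw [Filter.not_frequently] at hcon
        exact hcon.mono fun k hk => not_lt.1 hk
      obtain ⟨φ, hφ, hφP⟩ := extraction_forall_of_frequently hB'
      have hns' : Tendsto (fun n : ℕ => ns (φ n)) atTop atTop := hns.comp hφ.tendsto_atTop
      refine ⟨φ, ?_⟩
      have hsub : SubLogSqEnstrophy h (fun n => ν (ns (φ n))) (fun n => v (ns (φ n))) := by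
        show Tendsto (fun n => meanEnstrophy (v (ns (φ n))) / Real.log (1 / ν (ns (φ n))) ^ 2) atTop (𝓝 0)
        refine squeeze_zero (fun n => div_nonneg (hZnn _) (sq_nonneg _)) (fun n => ?_)
          tendsto_one_div_add_atTop_nhds_zero_nat
        -- `Z/L ≤ 1/(n+1)` from `Z < L/(n+1)` (and trivially when `L = 0`)
        have hP := hφP n
        rcases (sq_nonneg (Real.log (1 / ν (ns (φ n))))).eq_or_lt with hL | hL
        · rw [← hL, div_zero]; positivity
        · rw [div_le_iff₀ hL]; exact hP.le
      exact hSub g h hgs hgd hgm hhs hhm (fun n => ν (ns (φ n))) (fun n => v₀ (ns (φ n)))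
        (fun n => v (ns (φ n))) (fun n => θ₀ (ns (φ n))) (fun n => θ (ns (φ n)))
        (fun n => hν _) (hν0.comp hns') (fun n => hvLH _) (fun n => hθ₀ _) (fun n => hθ _)
        (by obtain ⟨E', hE'⟩ := hEv; exact ⟨E', fun n => hE' _⟩)
        (by obtain ⟨E', hE'⟩ := hEθ; exact ⟨E', fun n => hE' _⟩) hsub
  -- planar half: Alexakis–Doering
  have hV0 : Tendsto (fun j => meanDissipation (ν j) (v j)) atTop (𝓝 0) :=
    h₃ g hgs hgd hgm ν v₀ v hν hν0 hvLH hEv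
  -- squeeze
  have hsum : Tendsto (fun j => meanDissipation (ν j) (v j) + D j) atTop (𝓝 0) := by
    simpa using hV0.add hD0
  exact squeeze_zero (fun j => meanDissipation_nonneg (hν j).le (u j)) (fun j => hsplit j) hsum

/-- **The line closes the crux BY NAME**, fed with the six registered stubs (the audit sees `TwohalfdNeg` inhabited
modulo the six `sorry`s and nothing else). -/
theorem TwohalfdNeg_of : TwohalfdNeg :=
  twohalfdNeg_glue stub_logSplittingCost stub_subLogSqNoAnomaly stub_planarEnergyDissipationVanishes
    stub_twoHalfSplit stub_ageDecoupling stub_highEnstrophyQuiet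

end Summit.AnomalousDissipation.AnomalousDissipation.Cruxes.TwohalfdNeg.ReplicaLogCostEnstrophyThreshold

end
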